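import Summits.BirchSwinnertonDyer.BirchSwinnertonDyer.Theorems.EisensteinDepletionAtTwoStarGO2PrimeSqEtaleTwoTorsion
import Summits.BirchSwinnertonDyer.BirchSwinnertonDyer.Theorems.EisensteinDepletionAtTwoStarGO2PrimeSqDiophantineII
import Literature.NumberTheory.EllipticCurves.LambdaInvariantCongruenceTransportAtTwo
import Literature.NumberTheory.EllipticCurves.CuspFormLFunctionLevelConductorProofs
import Literature.NumberTheory.EllipticCurves.PrimeConductorTwoTorsionProofs
import Summits.BirchSwinnertonDyer.BirchSwinnertonDyer.Theorems.EisensteinDepletionAtTwoStarOggSaitoAtThree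
import Summits.BirchSwinnertonDyer.BirchSwinnertonDyer.Theorems.EisensteinDepletionAtTwoStarOptBTwoTorsionOfIsogenous
import Literature.NumberTheory.EllipticCurves.IsogenyFrobeniusTraceHoldsProofs
import Literature.NumberTheory.EllipticCurves.EichlerShimuraConstruction
import HarnessLib

/-!
# The prime-square edge of E1M's children `StarGO2` / `StarOptB` (items stmt-BirchSwinnertonDyer-24444 /
# 24445; parent crux `DepletedLambdaLawAtTwoMod`, stmt-BirchSwinnertonDyer-20341, line `star`):
# no rational `2`-torsion at conductor `p²`, `p ≡ ±3 (mod 8)` — both children are vacuous there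

Planner bsd-rank2-p2 GEN 29 (memo `HOME/p2/g29/GO2-via-UBD.md` §8–8a; ray law (RL0), kit j301225) isolated the
conductors `N = p²`, `p ≡ ±3 (mod 8)` as the one place where the depleted Eisenstein ray of line `star` is
ramified, so that the parity law of `StarGO2` cannot be satisfied and the crux must hold vacuously there. This
file closes that edge for BOTH research children of E1M, in their own currency:

* `star_primeSq_twoTorsion_classify` — an elliptic curve over `ℚ` of conductor `p²` (`p` an odd prime) with a
  rational point of order `2` has `p = 7`, `p = 17` or `p ≡ 1 (mod 8)` (étale points: type I,
  `PrimeSq.typeI_classify`; formal points: type II, `PrimeSq.typeII_classify`; realised by `49a`, `289a` and the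
  twists of the Neumann–Setzer curves, conductor `(a² + 64)²`).
* `star_primeSq_noRationalTwoTorsion` — hence NO rational `2`-torsion at conductor `p²`, `p % 8 ∈ {3, 5}`.
* `starOptB_primeSq_false_hyp` — UNCONDITIONAL: the hypothesis `HasUniqueRationalTwoTorsionX W x` of `StarOptB`
  is contradictory for a carrier `W` of conductor `p²`, `p % 8 ∈ {3, 5}` (so `StarOptB` holds there by
  `False.elim`).
* `conductorNorm_eq_of_isNewformOf_of_modularity`, `starGO2_primeSq_vacuous`, `starGO2_primeSq_false_hyp` —
  granted E1M's own antecedent (a newform at the conductor level for every elliptic curve; used only to move the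
  conductor from the carrier `W` to the optimal model `W₀` through the shared newform, by Atkin–Lehner strong
  multiplicity one `IsNewformOf.level_eq_level`), the hypotheses `HasRationalTwoTorsionX W₀ x₀`,
  `¬ TwoTorsionRamifiedAtTwo x₀` of `StarGO2` are contradictory at carrier conductor `p²`, `p % 8 ∈ {3, 5}`.

HONEST FRAMING: closes ONE edge (conductor `p²`, `p ≡ ±3 (8)`) of two OPEN cruxes; `StarGO2`, `StarOptB`, E1M
are NOT proved; nothing reads an analytic rank; BSD is not proved by any of this.

References: [Setzer1975] B. Setzer, *Elliptic curves of prime conductor*, J. London Math. Soc. (2) 10 (1975),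
§2; [Ivorra2004] W. Ivorra, Dissertationes Math. 429 (2004), §2.1; [AtkinLehner1970] A. O. L. Atkin,
J. Lehner, *Hecke operators on Γ₀(m)*, Math. Ann. 185 (1970), Thm. 4; [SilvermanAEC2009] VII.5.1, VIII.8.
-/

set_option linter.dupNamespace false
set_option autoImplicit false

namespace Summit.BirchSwinnertonDyer.BirchSwinnertonDyer.Theorems.DepletionAtTwo

open WeierstrassCurve IsDedekindDomain Rat.HeightOneSpectrum
open Literature.NumberTheory.EllipticCurves Literature.NumberTheory.EllipticCurves.Greenberg1999
open Literature.NumberTheory.EllipticCurves.PrimeConductorTwoTorsion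
open Literature.NumberTheory.EllipticCurves.ModularForms

namespace PrimeSq

/-! ## §1 The `2`-torsion normal form at conductor `p²` (both `2`-adic types) -/

/-- **Normal form at conductor `p²`.** For `W/ℚ` globally minimal of conductor `p²` (`p` an odd prime) with a
rational `2`-torsion abscissa: there are integers `A`, `B` and `k ≥ 1` with `B²(A² − 4B) = ±2⁸pᵏ`,
`p ∣ A² − 3B` (additive reduction), and either type I (`A ≡ 1 (mod 4)`, `8 ∣ B`) or type II (`B` odd,
`A = 2A₁`, `A₁ ≡ 3 (mod 4)`) — the model `y² = x³ + Ax² + Bx` of the integral minimal model, `ξ = 4x₀`,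
`A = b₂ + 3ξ`, `B = 3ξ² + 2b₂ξ + 8b₄`. [cite: Setzer1975, §2; Ivorra2004, §2.1; SilvermanAEC2009, III.1 Table 3.1] -/
theorem normalForm_of_conductorNorm_eq_sq (W : WeierstrassCurve ℚ) [W.IsElliptic] [W.IsGloballyMinimal]
    {p : ℕ} (hp : p.Prime) (hp2 : p ≠ 2) (hN : W.conductorNorm ℤ = p ^ 2) {x₀ : ℚ}
    (hx₀ : HasRationalTwoTorsionX W x₀) :
    ∃ (A B : ℤ) (k : ℕ), 1 ≤ k ∧
      (B ^ 2 * (A ^ 2 - 4 * B) = 2 ^ 8 * (p : ℤ) ^ k ∨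
        B ^ 2 * (A ^ 2 - 4 * B) = -(2 ^ 8 * (p : ℤ) ^ k)) ∧
      (p : ℤ) ∣ A ^ 2 - 3 * B ∧
      ((A % 4 = 1 ∧ (8 : ℤ) ∣ B) ∨ (Odd B ∧ ∃ A₁ : ℤ, A = 2 * A₁ ∧ A₁ % 4 = 3)) := by
  -- adapted from `ramified_or_typeI` (same file family) / `exists_normalForm_of_prime_conductorNorm`
  set W₀ : WeierstrassCurve ℤ := integralModelInt W with hW₀def
  have hW₀ : W₀.baseChange ℚ = W := baseChange_integralModelInt W
  haveI hell : (W₀.baseChange ℚ).IsElliptic := by rw [hW₀]; infer_instance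
  have hmin : ∀ v : HeightOneSpectrum ℤ, (W₀.baseChange ℚ).IsMinimalAt v := fun v ↦ by
    rw [hW₀]; exact IsGloballyMinimal.isMinimalAt_int W v
  have hN' : (W₀.baseChange ℚ).conductorNorm ℤ = p ^ 2 := by rw [hW₀]; exact hN
  obtain ⟨k, hk1, hΔ, hc4⟩ := localData_of_conductorNorm_eq_sq W₀ hmin hp hN'
  rw [← hW₀] at hx₀
  obtain ⟨y₀, heq, h2⟩ := hx₀
  have hb₂ : (W₀.baseChange ℚ).b₂ = (W₀.b₂ : ℚ) := by simp [WeierstrassCurve.baseChange]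
  have hb₄ : (W₀.baseChange ℚ).b₄ = (W₀.b₄ : ℚ) := by simp [WeierstrassCurve.baseChange]
  have hb₆ : (W₀.baseChange ℚ).b₆ = (W₀.b₆ : ℚ) := by simp [WeierstrassCurve.baseChange]
  have hcubic := cubic_eq_zero (W₀.baseChange ℚ) heq h2
  rw [hb₂, hb₄, hb₆] at hcubic
  obtain ⟨ξ, hξ⟩ := exists_int_eq_of_cubic W₀ hcubic
  have hcubicZ : ξ ^ 3 + W₀.b₂ * ξ ^ 2 + 8 * W₀.b₄ * ξ + 16 * W₀.b₆ = 0 := by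
    have : ((ξ ^ 3 + W₀.b₂ * ξ ^ 2 + 8 * W₀.b₄ * ξ + 16 * W₀.b₆ : ℤ) : ℚ) = 0 := by
      push_cast; rw [hξ]; exact hcubic
    exact_mod_cast this
  set A : ℤ := W₀.b₂ + 3 * ξ with hA
  set B : ℤ := 3 * ξ ^ 2 + 2 * W₀.b₂ * ξ + 8 * W₀.b₄ with hB
  set C₂ : VariableChange ℚ := ⟨⟨1 / 2, 2, by norm_num, by norm_num⟩, x₀, -(W₀.baseChange ℚ).a₁ / 2, y₀⟩
    with hC₂
  have hmodel : C₂ • (W₀.baseChange ℚ) = ⟨0, (A : ℚ), 0, (B : ℚ), 0⟩ := by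
    rw [hC₂, smul_eq_twoTorsionModel (W₀.baseChange ℚ) heq h2, hb₂, hb₄, ← hξ, hA, hB]
    push_cast
    ring_nf
  have hΔmodel : (16 : ℚ) * (B : ℚ) ^ 2 * ((A : ℚ) ^ 2 - 4 * B) = 2 ^ 12 * (W₀.Δ : ℚ) := by
    have h1 := congrArg WeierstrassCurve.Δ hmodel
    rw [variableChange_Δ, Δ_twoTorsionModel, baseChange_int_Δ] at h1
    have hu : (((⟨1 / 2, 2, by norm_num, by norm_num⟩ : ℚˣ)⁻¹ : ℚˣ) : ℚ) = 2 := rfl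
    rw [hC₂] at h1
    simp only [hu] at h1
    linear_combination -h1
  have hdisc : B ^ 2 * (A ^ 2 - 4 * B) = 2 ^ 8 * W₀.Δ := by
    have : ((B ^ 2 * (A ^ 2 - 4 * B) : ℤ) : ℚ) = ((2 ^ 8 * W₀.Δ : ℤ) : ℚ) := by
      push_cast; linear_combination hΔmodel / 16
    exact_mod_cast this
  have hc4' : (p : ℤ) ∣ A ^ 2 - 3 * B := by rw [hA, hB, sq_sub_three_mul_eq_c₄]; exact hc4
  have hpodd : Odd (p : ℤ) := by exact_mod_cast hp.odd_of_ne_two hp2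
  have hΔodd : Odd W₀.Δ := by
    rcases hΔ with h | h <;> rw [h]
    · exact hpodd.pow
    · exact hpodd.pow.neg
  have ha₁odd : Odd W₀.a₁ := by
    rcases odd_a₁_or_odd_a₃_of_odd_Δ W₀ hΔodd with h | h
    · exact h
    · by_contra hev
      rw [Int.not_odd_iff_even] at hev
      exact no_root_of_even_a₁_odd_a₃ W₀ hev h ξ hcubicZ
  obtain ⟨e, he⟩ := b₂_eq_of_odd_a₁ W₀ ha₁odd
  have hb₂odd : Odd W₀.b₂ := ⟨4 * e + 2 * W₀.a₂, by rw [he]; ring⟩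
  refine ⟨A, B, k, hk1, ?_, hc4', ?_⟩
  · rcases hΔ with h | h
    · left; rw [hdisc, h]
    · right; rw [hdisc, h]; ring
  · rcases odd_or_four_dvd W₀.b₂ W₀.b₄ W₀.b₆ ξ hb₂odd hcubicZ with ⟨hξodd, h8⟩ | h4
    · right; exact typeII W₀.b₂ W₀.b₄ W₀.a₂ e ξ he hξodd h8
    · left; exact typeI W₀.b₂ W₀.b₄ W₀.a₂ e ξ he h4

end PrimeSq

/-! ## §2 Rational `2`-torsion at conductor `p²` -/

/-- **Classification of rational `2`-torsion at conductor `p²`.** An elliptic curve over `ℚ` (globally minimal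
model) of conductor `p²`, `p` an odd prime, with a rational point of order `2` has `p = 7`, `p = 17` or
`p ≡ 1 (mod 8)`. [cite: Setzer1975, §2 (descent on the 2-torsion normal form; here at an additive prime)] -/
theorem star_primeSq_twoTorsion_classify (W : WeierstrassCurve ℚ) [W.IsElliptic] [W.IsGloballyMinimal]
    {p : ℕ} (hp : p.Prime) (hp2 : p ≠ 2) (hN : W.conductorNorm ℤ = p ^ 2) {x₀ : ℚ}
    (hx₀ : HasRationalTwoTorsionX W x₀) : p = 7 ∨ p = 17 ∨ p % 8 = 1 := by
  obtain ⟨A, B, k, hk, hD, hC, hI | ⟨hBodd, A₁, rfl, hA₁⟩⟩ :=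
    PrimeSq.normalForm_of_conductorNorm_eq_sq W hp hp2 hN hx₀
  · exact PrimeSq.typeI_classify hp hp2 hk hD hC hI.1 hI.2
  · exact PrimeSq.typeII_classify hp hp2 hD hC hA₁ hBodd

/-- **No rational `2`-torsion at conductor `p²`, `p ≡ ±3 (mod 8)`** (globally minimal model; the property is
model-independent). [cite: Setzer1975, §2] -/
theorem star_primeSq_noRationalTwoTorsion (W : WeierstrassCurve ℚ) [W.IsElliptic] [W.IsGloballyMinimal]
    {p : ℕ} (hp : p.Prime) (hN : W.conductorNorm ℤ = p ^ 2) (hp8 : p % 8 = 3 ∨ p % 8 = 5) (x₀ : ℚ) :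
    ¬ HasRationalTwoTorsionX W x₀ := by
  intro hx₀
  have hp2 : p ≠ 2 := by omega
  rcases star_primeSq_twoTorsion_classify W hp hp2 hN hx₀ with h | h | h <;> omega

/-! ## §3 The edge in the currency of `StarOptB` (unconditional) -/

/-- **`StarOptB` is vacuous at carrier conductor `p²`, `p ≡ ±3 (mod 8)`**: its hypothesis
`HasUniqueRationalTwoTorsionX W x` (a rational point of order `2` on the habitat curve `W`) cannot hold when
`N_W = p²`, `p % 8 ∈ {3, 5}`. Unconditional. [cite: Setzer1975, §2] -/
theorem starOptB_primeSq_false_hyp (W : WeierstrassCurve ℚ) [W.IsElliptic] [W.IsGloballyMinimal]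
    {p : ℕ} (hp : p.Prime) (hN : W.conductorNorm ℤ = p ^ 2) (hp8 : p % 8 = 3 ∨ p % 8 = 5) {x : ℚ}
    (hx : HasUniqueRationalTwoTorsionX W x) : False :=
  star_primeSq_noRationalTwoTorsion W hp hN hp8 x hx.1

/-! ## §4 The edge in the currency of `StarGO2` (granted E1M's modularity antecedent) -/

/-- **Conductor transfer along a shared newform, granted modularity at the conductor level.** If every
elliptic curve over `ℚ` has a newform at its conductor level (E1M's antecedent) and `W`, `W₀` share a newform
`f` (of some level `N`), then `N_W = N_{W₀}` (both equal `N` by Atkin–Lehner strong multiplicity one,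
`IsNewformOf.level_eq_level`). [cite: AtkinLehner1970, Thm. 4] -/
theorem conductorNorm_eq_of_isNewformOf_of_modularity
    (hmod : ∀ (V : WeierstrassCurve ℚ) [V.IsElliptic] [NeZero (V.conductorNorm ℤ)],
      ∃ g : CuspForm (CongruenceSubgroup.Gamma0 (V.conductorNorm ℤ)) 2, IsNewformOf V g)
    {W W₀ : WeierstrassCurve ℚ} [W.IsElliptic] [W₀.IsElliptic] {N : ℕ} [NeZero N]
    {f : CuspForm (CongruenceSubgroup.Gamma0 N) 2} (hf : IsNewformOf W f) (hf₀ : IsNewformOf W₀ f) :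
    W.conductorNorm ℤ = W₀.conductorNorm ℤ := by
  haveI : NeZero (W.conductorNorm ℤ) := ⟨(W.conductorNorm_pos_holds).ne'⟩
  haveI : NeZero (W₀.conductorNorm ℤ) := ⟨(W₀.conductorNorm_pos_holds).ne'⟩
  obtain ⟨g, hg⟩ := hmod W
  obtain ⟨g₀, hg₀⟩ := hmod W₀
  exact (IsNewformOf.level_eq_level hf hg).symm.trans (IsNewformOf.level_eq_level hf₀ hg₀)

/-- **`StarGO2` is vacuous at carrier conductor `p²`, `p ≡ ±3 (mod 8)`** (granted E1M's modularity
antecedent): for a carrier `W` of conductor `p²` with `p % 8 ∈ {3, 5}` and a globally minimal `W₀` with the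
same newform, every rational `2`-torsion abscissa of `W₀` is ramified at `2` (indeed there is none:
`star_primeSq_noRationalTwoTorsion` for `W₀`, whose conductor is `p²` by
`conductorNorm_eq_of_isNewformOf_of_modularity`). [cite: Setzer1975, §2; AtkinLehner1970, Thm. 4] -/
theorem starGO2_primeSq_vacuous
    (hmod : ∀ (V : WeierstrassCurve ℚ) [V.IsElliptic] [NeZero (V.conductorNorm ℤ)],
      ∃ g : CuspForm (CongruenceSubgroup.Gamma0 (V.conductorNorm ℤ)) 2, IsNewformOf V g)
    (W : WeierstrassCurve ℚ) [W.IsElliptic] (W₀ : WeierstrassCurve ℚ) [W₀.IsElliptic]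
    [W₀.IsGloballyMinimal] {N : ℕ} [NeZero N] (f : CuspForm (CongruenceSubgroup.Gamma0 N) 2)
    (hf : IsNewformOf W f) (hf₀ : IsNewformOf W₀ f) {p : ℕ} (hp : p.Prime)
    (hN : W.conductorNorm ℤ = p ^ 2) (hp8 : p % 8 = 3 ∨ p % 8 = 5) {x₀ : ℚ}
    (hx₀ : HasRationalTwoTorsionX W₀ x₀) : TwoTorsionRamifiedAtTwo x₀ := by
  have hN₀ : W₀.conductorNorm ℤ = p ^ 2 :=
    (conductorNorm_eq_of_isNewformOf_of_modularity hmod hf hf₀).symm.trans hN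
  exact star_primeSqEtaleTwoTorsion W₀ p hp hN₀ hp8 x₀ hx₀

/-- **The two `2`-torsion hypotheses of `StarGO2` are contradictory at carrier conductor `p²`,
`p ≡ ±3 (mod 8)`** (granted E1M's modularity antecedent): `HasRationalTwoTorsionX W₀ x₀` and
`¬ TwoTorsionRamifiedAtTwo x₀` give `False`, so the instance of `StarGO2` at such a carrier follows by
`False.elim`, independently of the (ramified) Eisenstein ray. [cite: Setzer1975, §2] -/
theorem starGO2_primeSq_false_hyp
    (hmod : ∀ (V : WeierstrassCurve ℚ) [V.IsElliptic] [NeZero (V.conductorNorm ℤ)],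
      ∃ g : CuspForm (CongruenceSubgroup.Gamma0 (V.conductorNorm ℤ)) 2, IsNewformOf V g)
    (W : WeierstrassCurve ℚ) [W.IsElliptic] (W₀ : WeierstrassCurve ℚ) [W₀.IsElliptic]
    [W₀.IsGloballyMinimal] {N : ℕ} [NeZero N] (f : CuspForm (CongruenceSubgroup.Gamma0 N) 2)
    (hf : IsNewformOf W f) (hf₀ : IsNewformOf W₀ f) {p : ℕ} (hp : p.Prime)
    (hN : W.conductorNorm ℤ = p ^ 2) (hp8 : p % 8 = 3 ∨ p % 8 = 5) {x₀ : ℚ}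
    (hx₀ : HasRationalTwoTorsionX W₀ x₀) (het : ¬ TwoTorsionRamifiedAtTwo x₀) : False :=
  het (starGO2_primeSq_vacuous hmod W W₀ f hf hf₀ hp hN hp8 hx₀)

/-! ## §5 All prime-power conductors (appended, lead GEN 5): Setzer (`k = 1`), this file (`k = 2`), Ogg–Saito (`k ≤ 2`) -/

/-- **Rational `2`-torsion at prime-power conductor `pᵏ` (`p` odd), classification.** `k = 1` and `p = 17` or
`p = u² + 64` (Setzer 1975, tree theorem `Setzer1975_primeConductor_rationalTwoTorsion_holds`), or `k = 2` and
`p ∈ {7, 17} ∨ p ≡ 1 (mod 8)` (`star_primeSq_twoTorsion_classify`); `k ≥ 3` is excluded by Ogg–Saito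
(`factorization_conductorNorm_le_two_of_hasRationalTwoTorsionX`). [cite: Setzer1975, Thm 2; Silverman1994, IV.10.2] -/
theorem star_primePow_twoTorsion_classify (W : WeierstrassCurve ℚ) [W.IsElliptic] [W.IsGloballyMinimal]
    {p k : ℕ} (hp : p.Prime) (hp2 : p ≠ 2) (hk : 1 ≤ k) (hN : W.conductorNorm ℤ = p ^ k) {x₀ : ℚ}
    (hx₀ : HasRationalTwoTorsionX W x₀) :
    (k = 1 ∧ (p = 17 ∨ ∃ u : ℤ, u % 4 = 3 ∧ (p : ℤ) = u ^ 2 + 64)) ∨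
      (k = 2 ∧ (p = 7 ∨ p = 17 ∨ p % 8 = 1)) := by
  have hfac := factorization_conductorNorm_le_two_of_hasRationalTwoTorsionX W hx₀ hp hp2
  rw [hN, Nat.Prime.factorization_pow hp, Finsupp.single_eq_same] at hfac
  rcases Nat.lt_or_ge k 2 with h1 | h2
  · -- `k = 1`: prime conductor, Setzer
    have hk1 : k = 1 := by omega
    subst hk1
    rw [pow_one] at hN
    left
    refine ⟨rfl, ?_⟩
    have hprime : (W.conductorNorm ℤ).Prime := by rw [hN]; exact hp
    rcases Setzer1975_primeConductor_rationalTwoTorsion_holds W x₀ hx₀ hprime with h17 | ⟨u, hu, hu64, -⟩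
    · left; rw [hN] at h17; exact h17
    · right; exact ⟨u, hu, by rw [hN] at hu64; exact_mod_cast hu64⟩
  · -- `k = 2`
    have hk2 : k = 2 := by omega
    subst hk2
    right
    exact ⟨rfl, star_primeSq_twoTorsion_classify W hp hp2 hN hx₀⟩

/-- **Prime-power conductor and a rational point of order `2` force `p ≡ 1 (mod 8)` or `N = 49`** (`17`,
`u² + 64` with `u` odd, and the `k = 2` list). In particular BOTH children of E1M are vacuous at every prime-power
carrier conductor `pᵏ` with `p ≡ ±3 (mod 8)`, and at `p ≡ 7 (mod 8)` unless `N = 49`. [cite: Setzer1975, Thm 2] -/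
theorem star_primePow_twoTorsion_mod_eight (W : WeierstrassCurve ℚ) [W.IsElliptic] [W.IsGloballyMinimal]
    {p k : ℕ} (hp : p.Prime) (hp2 : p ≠ 2) (hk : 1 ≤ k) (hN : W.conductorNorm ℤ = p ^ k) {x₀ : ℚ}
    (hx₀ : HasRationalTwoTorsionX W x₀) : p % 8 = 1 ∨ (p = 7 ∧ k = 2) := by
  rcases star_primePow_twoTorsion_classify W hp hp2 hk hN hx₀ with ⟨-, h17 | ⟨u, hu, hpu⟩⟩ | ⟨hk2, h7 | h17 | h1⟩
  · left; omega
  · left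
    have hsq := PrimeSq.sq_emod_eight_of_odd (Int.odd_iff.mpr (by omega) : Odd u)
    generalize u ^ 2 = s at hsq hpu
    omega
  · right; exact ⟨h7, hk2⟩
  · left; omega
  · left; exact h1

/-- **No rational `2`-torsion at prime-power conductor `pᵏ`, `p ≡ ±3 (mod 8)`.** [cite: Setzer1975, Thm 2] -/
theorem star_primePow_noRationalTwoTorsion (W : WeierstrassCurve ℚ) [W.IsElliptic] [W.IsGloballyMinimal]
    {p k : ℕ} (hp : p.Prime) (hk : 1 ≤ k) (hN : W.conductorNorm ℤ = p ^ k) (hp8 : p % 8 = 3 ∨ p % 8 = 5)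
    (x₀ : ℚ) : ¬ HasRationalTwoTorsionX W x₀ := by
  intro hx₀
  have hp2 : p ≠ 2 := by omega
  rcases star_primePow_twoTorsion_mod_eight W hp hp2 hk hN hx₀ with h | ⟨h, -⟩ <;> omega

/-! ## §6 The `StarGO2` edge WITHOUT modularity (appended, lead GEN 5): Faltings + the `2`-torsion transfer -/

/-- **The `2`-torsion hypothesis of `StarGO2` is contradictory at carrier conductor `pᵏ`, `p ≡ ±3 (mod 8)` —
UNCONDITIONALLY.** `W` and `W₀` share the newform `f`, so they are `ℚ`-isogenous (Faltings, tree theorem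
`WeierstrassCurve.isIsogenous_iff_frobeniusTrace_eq_holds` via `IsNewformOf.isIsogenous`); a rational point of order `2`
on `W₀` transfers to `W` (`stub_twoTorsionOfIsogenous`, eng-2 GEN 13), where `star_primePow_noRationalTwoTorsion` forbids
it. No conductor transfer, hence no modularity antecedent, is needed (this supersedes `starGO2_primeSq_false_hyp` for the
purposes of the skeleton). [cite: Faltings1983Endlichkeit, §5 Kor. 2; SilvermanAEC2009, III.6.4(b); Setzer1975, Thm 2] -/
theorem starGO2_primePow_false_hyp (W : WeierstrassCurve ℚ) [W.IsElliptic] [W.IsGloballyMinimal]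
    (W₀ : WeierstrassCurve ℚ) [W₀.IsElliptic] {N : ℕ} [NeZero N] (f : CuspForm (CongruenceSubgroup.Gamma0 N) 2)
    (hf : IsNewformOf W f) (hf₀ : IsNewformOf W₀ f) {p k : ℕ} (hp : p.Prime) (hk : 1 ≤ k)
    (hN : W.conductorNorm ℤ = p ^ k) (hp8 : p % 8 = 3 ∨ p % 8 = 5) {x₀ : ℚ}
    (hx₀ : HasRationalTwoTorsionX W₀ x₀) : False := by
  have hiso : WeierstrassCurve.IsIsogenous W₀ W :=
    IsNewformOf.isIsogenous WeierstrassCurve.isIsogenous_iff_frobeniusTrace_eq_holds hf₀ hf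
  obtain ⟨x, hx⟩ := stub_twoTorsionOfIsogenous W₀ W hiso ⟨x₀, hx₀⟩
  exact star_primePow_noRationalTwoTorsion W hp hk hN hp8 x hx

/-- **`StarGO2` is vacuous at carrier conductor `p²`, `p ≡ ±3 (mod 8)` — unconditional form** (the case `k = 2` of
`starGO2_primePow_false_hyp`, in the exact hypothesis shape of the stub). [cite: Setzer1975, Thm 2] -/
theorem starGO2_primeSq_false_hyp' (W : WeierstrassCurve ℚ) [W.IsElliptic] [W.IsGloballyMinimal]
    (W₀ : WeierstrassCurve ℚ) [W₀.IsElliptic] {N : ℕ} [NeZero N] (f : CuspForm (CongruenceSubgroup.Gamma0 N) 2)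
    (hf : IsNewformOf W f) (hf₀ : IsNewformOf W₀ f) {p : ℕ} (hp : p.Prime) (hN : W.conductorNorm ℤ = p ^ 2)
    (hp8 : p % 8 = 3 ∨ p % 8 = 5) {x₀ : ℚ} (hx₀ : HasRationalTwoTorsionX W₀ x₀) : False :=
  starGO2_primePow_false_hyp W W₀ f hf hf₀ hp (by norm_num) hN hp8 hx₀

end Summit.BirchSwinnertonDyer.BirchSwinnertonDyer.Theorems.DepletionAtTwo
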